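import Literature.NumberTheory.Rogawski1990.ArchCentralLimitFormulaOfCM      -- ★ p843608 (A-p18): `archCentralLimitFormulaRankTwo_of_cm_signs` (the letter everywhere from the six `±1`-frames of `ℚ(ζ₅)`)
import Literature.NumberTheory.Rogawski1990.ArchCentralLimitFormulaOfPerm    -- FILE A (F0P3a-p02 (g13)): `archCentralLimitFormulaRankTwo_of_perm` (relabelling transport)
import HarnessLib

/-!
# N1 CLOSURE SHAPE: the `∀ (L, α, w)` letter `ArchCentralLimitFormulaRankTwo` from its instances at CM frames whose COMPACT pair is `{0,1}` and whose pair `{0,2}` is NONCOMPACT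
# (Rogawski 1990 §8.4 pp. 126–127 — the statement is about `U(2,1)`; which diagonal slot carries the odd sign is bookkeeping)

Topic `NumberTheory/Rogawski1990`; namespace `Literature.NumberTheory.Rogawski1990`.  THEOREMS ONLY (no `def`, no instance, no notation, no axiom, no named fact, no `sorry`).
Cell `pub/hodgecm-mathlib`, ENGINE T1 (crux H413 = `stmt-HodgeConjecture-24833`); ROAD A toward N1 = the registered stub `stub_L21 : ∀ L α w, ArchCentralLimitFormulaRankTwo L α w`
(closer ED. 25∕26) ∕ `stub_ArchCentralLimitU21` («SdArch» ED. 3); ROAD A owner F0P3a-p05 (g14) WORD R-14.3 (d) «ASSEMBLY-READINESS», «=» 11:31:11Z (FILE C of F0P3a-p02 (g13)'s census).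

THE THEOREM **`archCentralLimitFormulaRankTwo_of_compactPair01`**: IF the letter holds at every CM frame `(L₀, α₀, w₀)` with `re σ_{w₀}α₀₀ · re σ_{w₀}α₀₁ > 0` (slots `0,1` the compact pair) and
`re σ_{w₀}α₀₀ · re σ_{w₀}α₀₂ < 0` (the pair `{0,2}` noncompact) — the shape in which ROAD A proves it (★ FILE B `ArchCentralLimitFormulaRankTwo.of_cornerRegularity_of_wallValues`: compact wall
`θ₀ = θ₁`, (h4)∕(J3-odd) across `θ₀ = θ₂`) — THEN it holds at every `(L, α, w)`.  PROOF: ★ `archCentralLimitFormulaRankTwo_of_cm_signs` reduces to the eight `±1`-frames `s` of `ℚ(ζ₅)`;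
`(1,1,1)`, `(−1,−1,−1)` are vacuous (the letter's indefiniteness guard fails); `(1,1,−1)`, `(−1,−1,1)` are the hypothesis; `(1,−1,1)`, `(−1,1,−1)` (compact pair `{0,2}`) and `(1,−1,−1)`,
`(−1,1,1)` (compact pair `{1,2}`) are RELABELLINGS by `swap 1 2` resp. `swap 0 2` of hypothesis frames (★ FILE A `archCentralLimitFormulaRankTwo_of_perm`).
END STATE OF N1: `stub_L21 := archCentralLimitFormulaRankTwo_of_compactPair01 (fun L₀ _ _ _ α₀ w₀ h01 h02 => of_cornerRegularity_of_wallValues h02 (hA6 L₀ α₀ w₀) (W6 …) (Z5 …))`.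
HONEST LABEL: HC_CM is proved only modulo the printed citations until rung 0 closes; this file is bookkeeping over ★ (G) and ★ FILE A and pays nothing by itself.

## References
* [Rogawski1990] J. D. Rogawski, *Automorphic Representations of Unitary Groups in Three Variables*, Ann. of Math. Stud. 123 (1990), §8.4 pp. 126–127.
* [PlatonovRapinchuk1994] V. Platonov, A. Rapinchuk, *Algebraic Groups and Number Theory* (1994), §2.3.
-/

set_option autoImplicit false

noncomputable section

open NumberField NumberField.InfinitePlace

namespace Literature.NumberTheory.Rogawski1990

section Closure

/-- A frame with NO indefinite pair satisfies the letter vacuously (its indefiniteness guard fails). [cite: Rogawski1990, §8.4 p. 126] -/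
theorem archCentralLimitFormulaRankTwo_of_forall_mul_re_nonneg (L : Type) [Field L] (α : Fin 3 → L) (w : {w : InfinitePlace L // IsComplex w})
    (hre : ∀ i j : Fin 3, 0 ≤ (w.1.embedding (α i)).re * (w.1.embedding (α j)).re) : ArchCentralLimitFormulaRankTwo L α w := by
  intro _ _ _ _ _ _ hind ν _ _
  obtain ⟨i, j, hlt⟩ := hind
  exact absurd hlt (not_lt.2 (hre i j))

/-- The hypothesis «letter at every CM frame with compact pair `{0,1}` and noncompact pair `{0,2}`», applied through a relabelling `σ`: if the slots `σ0, σ1` of `α₀` carry the same sign and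
`σ0, σ2` opposite signs, the letter holds at `(L₀, α₀, w₀)` (★ FILE A). [cite: Rogawski1990, §8.4 pp. 126–127] -/
theorem archCentralLimitFormulaRankTwo_of_compactPair
    (h : ∀ (L₀ : Type) [Field L₀] [NumberField L₀] [IsCMField L₀] (α₀ : Fin 3 → L₀) (w₀ : {w : InfinitePlace L₀ // IsComplex w}),
      0 < (w₀.1.embedding (α₀ 0)).re * (w₀.1.embedding (α₀ 1)).re → (w₀.1.embedding (α₀ 0)).re * (w₀.1.embedding (α₀ 2)).re < 0 →
      ArchCentralLimitFormulaRankTwo L₀ α₀ w₀)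
    (L₀ : Type) [Field L₀] [NumberField L₀] [IsCMField L₀] (α₀ : Fin 3 → L₀) (w₀ : {w : InfinitePlace L₀ // IsComplex w}) (σ : Equiv.Perm (Fin 3))
    (hpos : 0 < (w₀.1.embedding (α₀ (σ 0))).re * (w₀.1.embedding (α₀ (σ 1))).re)
    (hneg : (w₀.1.embedding (α₀ (σ 0))).re * (w₀.1.embedding (α₀ (σ 2))).re < 0) :
    ArchCentralLimitFormulaRankTwo L₀ α₀ w₀ := by
  intro _ _ _ _ hα hreal hind ν _ _
  exact archCentralLimitFormulaRankTwo_of_perm L₀ α₀ w₀ σ (h L₀ (α₀ ∘ ⇑σ) w₀ hpos hneg) hα hreal hind ν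

/-- Values of `swap 1 2` on `Fin 3`. [cite: Rogawski1990, §8.4 p. 126] -/
theorem perm_swap12_apply : (Equiv.swap (1 : Fin 3) 2) 0 = 0 ∧ (Equiv.swap (1 : Fin 3) 2) 1 = 2 ∧ (Equiv.swap (1 : Fin 3) 2) 2 = 1 := by
  decide

/-- Values of `swap 0 2` on `Fin 3`. [cite: Rogawski1990, §8.4 p. 126] -/
theorem perm_swap02_apply : (Equiv.swap (0 : Fin 3) 2) 0 = 2 ∧ (Equiv.swap (0 : Fin 3) 2) 1 = 1 ∧ (Equiv.swap (0 : Fin 3) 2) 2 = 0 := by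
  decide

/-- **N1 CLOSURE SHAPE — `ArchCentralLimitFormulaRankTwo` AT EVERY `(L, α, w)` FROM THE CM FRAMES WITH COMPACT PAIR `{0,1}` AND NONCOMPACT PAIR `{0,2}`.**  (★ `…_of_cm_signs` + the eight
`±1`-frames of `ℚ(ζ₅)`: two vacuous, two the hypothesis, four relabelled by `swap 1 2` ∕ `swap 0 2` through ★ FILE A.) [cite: Rogawski1990, §8.4 pp. 126–127] [cite: PlatonovRapinchuk1994, §2.3] -/
theorem archCentralLimitFormulaRankTwo_of_compactPair01
    (h : ∀ (L₀ : Type) [Field L₀] [NumberField L₀] [IsCMField L₀] (α₀ : Fin 3 → L₀) (w₀ : {w : InfinitePlace L₀ // IsComplex w}),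
      0 < (w₀.1.embedding (α₀ 0)).re * (w₀.1.embedding (α₀ 1)).re → (w₀.1.embedding (α₀ 0)).re * (w₀.1.embedding (α₀ 2)).re < 0 →
      ArchCentralLimitFormulaRankTwo L₀ α₀ w₀)
    (L : Type) [Field L] (α : Fin 3 → L) (w : {w : InfinitePlace L // IsComplex w}) : ArchCentralLimitFormulaRankTwo L α w := by
  haveI : IsCMField (CyclotomicField 5 ℚ) :=   -- Mathlib (as in ★ `ArchCentralLimitFormulaOfCM`)
    @IsCyclotomicExtension.Rat.isCMField (CyclotomicField 5 ℚ) _ _ {5} ⟨5, rfl, by norm_num⟩ (CyclotomicField.isCyclotomicExtension 5 ℚ)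
  have key : ∀ (s : Fin 3 → CyclotomicField 5 ℚ), (∀ i, s i = 1 ∨ s i = -1) →
      ∀ w₀ : {w : InfinitePlace (CyclotomicField 5 ℚ) // IsComplex w}, ArchCentralLimitFormulaRankTwo (CyclotomicField 5 ℚ) s w₀ := by
    intro s hs w₀
    have hr : ∀ i, (w₀.1.embedding (s i)).re = 1 ∨ (w₀.1.embedding (s i)).re = -1 := fun i => by
      rcases hs i with h1 | h1
      · left; rw [h1, map_one, Complex.one_re]
      · right; rw [h1, map_neg, map_one, Complex.neg_re, Complex.one_re]
    obtain ⟨a0, a1, a2⟩ := perm_swap12_apply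
    obtain ⟨b0, b1, b2⟩ := perm_swap02_apply
    intro _ _ _ _ hα hreal hind ν _ _
    rcases hr 0 with h0 | h0 <;> rcases hr 1 with h1 | h1 <;> rcases hr 2 with h2 | h2
    · -- (1,1,1): vacuous
      have hall : ∀ i, (w₀.1.embedding (s i)).re = 1 := fun i => match i with | 0 => h0 | 1 => h1 | 2 => h2
      obtain ⟨i, j, hlt⟩ := hind
      rw [hall i, hall j] at hlt
      norm_num at hlt
    · -- (1,1,−1): the hypothesis
      exact h _ s w₀ (by rw [h0, h1]; norm_num) (by rw [h0, h2]; norm_num) hα hreal hind ν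
    · -- (1,−1,1): compact pair {0,2} — relabel by `swap 1 2`
      exact archCentralLimitFormulaRankTwo_of_compactPair h _ s w₀ (Equiv.swap 1 2) (by rw [a0, a1, h0, h2]; norm_num) (by rw [a0, a2, h0, h1]; norm_num)
        hα hreal hind ν
    · -- (1,−1,−1): compact pair {1,2} — relabel by `swap 0 2`
      exact archCentralLimitFormulaRankTwo_of_compactPair h _ s w₀ (Equiv.swap 0 2) (by rw [b0, b1, h2, h1]; norm_num) (by rw [b0, b2, h2, h0]; norm_num)
        hα hreal hind ν
    · -- (−1,1,1): compact pair {1,2} — relabel by `swap 0 2`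
      exact archCentralLimitFormulaRankTwo_of_compactPair h _ s w₀ (Equiv.swap 0 2) (by rw [b0, b1, h2, h1]; norm_num) (by rw [b0, b2, h2, h0]; norm_num)
        hα hreal hind ν
    · -- (−1,1,−1): compact pair {0,2} — relabel by `swap 1 2`
      exact archCentralLimitFormulaRankTwo_of_compactPair h _ s w₀ (Equiv.swap 1 2) (by rw [a0, a1, h0, h2]; norm_num) (by rw [a0, a2, h0, h1]; norm_num)
        hα hreal hind ν
    · -- (−1,−1,1): the hypothesis
      exact h _ s w₀ (by rw [h0, h1]; norm_num) (by rw [h0, h2]; norm_num) hα hreal hind ν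
    · -- (−1,−1,−1): vacuous
      have hall : ∀ i, (w₀.1.embedding (s i)).re = -1 := fun i => match i with | 0 => h0 | 1 => h1 | 2 => h2
      obtain ⟨i, j, hlt⟩ := hind
      rw [hall i, hall j] at hlt
      norm_num at hlt
  intro _ _ _ _ hα hreal hind ν _ _
  exact archCentralLimitFormulaRankTwo_of_cm_signs key L α w hα hreal hind ν

end Closure

end Literature.NumberTheory.Rogawski1990

end
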